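import Summits.BirchSwinnertonDyer.Rank1Residual.X12.O11.RamifiedReciprocityFrom
import Summits.BirchSwinnertonDyer.BirchSwinnertonDyer.Theorems.RamifiedSevenEllipticUnitsHvanRepaired
import HarnessLib

set_option linter.dupNamespace false
set_option autoImplicit false

/-!
# O11 / K7r line `rubin-formula-zp` (crux `EllipticUnitValueSevenOfGZK`, stmt-BirchSwinnertonDyer-19945):
# (B1′) OVER THE REPAIRED RECIPROCITY PREDICATE `X12.O11.HasReciprocityFrom` — `z(𝟙) ∈ S_p(E/K)` from the
# φ-pin — and the referee's two ACCEPTANCE GATES (planner D121 (b)(i)): (i) the χ = 𝟙 reduction at level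
# 0 explicit, (ii) the predicate EXERCISED at the constructible pair `(𝟙, r_triv)` (no vacuous firing)
# (cell `bsd-cm`, seat `bsd-cm-k7r-c4` g6; THEOREMS ONLY; `--supports` 19945)

HONEST FRAMING. Nothing about BSD is claimed; the crux 19945 stays OPEN (one open stub S_open). (B1′) is
NOT on the S_sat critical path any more (S_sat-Zp is a theorem by the rank route, p479978/p478864); it is
the first ANALYTIC consequence the repaired datum interface yields, needed before any S_open work leans on
the reciprocity law. The proofs are assemblies of seat k7r-c3 g7's `HvanAnatomy`/`HvanRepaired` lemmas
(level-`0` rigidity `eq_one_of_isAcCharacter_zero`, `isAcCharacter_zero_one_one`; the pin lemmas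
`hasEntireContinuationFrom_of_pin`, `entireContinuationFrom_eq_entireLFunction_of_pin`, `hvan'_of_pin`;
(B1′) `bottom_mem_compactSelmerOver_of_erl'`) with this seat's predicate `HasReciprocityFrom` (repair (R-a)).

* `delta_zero_eq_of_hasReciprocityFrom` (GATE (ii)): under the pin and `W.HasEntireLFunction`, the
  predicate FIRES at `(𝟙, 𝟙)` — its continuation antecedent is inhabited — and gives the genuine equation
  `δ 0 𝟙 (z 0) = ι⁻¹(L(W, 1)/Ω)`.
* `delta_zero_eq_zero_of_hasReciprocityFrom` (GATE (i)+(ii)): for EVERY level-`0` pair (χ, r) — which is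
  `(𝟙, 𝟙)` by rigidity — `δ 0 r (z 0) = 0` in positive analytic rank.
* `bottom_mem_compactSelmerOver_of_hasReciprocityFrom` (B1′): `z(𝟙) ∈ S_p(E/K)` from `HasReciprocityFrom D`,
  the pin, `L(W, ·)` entire and `r_an(W) ≠ 0`; and its `hasEntireLFunction_rat`-fed form.

References: [BKNO] arXiv:2608.06879v1 Prop. 4.10, Lemma 7.1 [BurungaleKobayashiNakamuraOta2026];
J. Silverman, *Advanced Topics* II Thm. 10.5 [SilvermanATAEC1994]; cell: MEMO-k7r-c4-g6-CONTINUATION.md,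
REFEREE-COUNTERSIGN-DEFECT2-G39.md, STATUS D121.
-/

noncomputable section

open scoped Classical

open WeierstrassCurve NumberField IsDedekindDomain Field
  Literature.NumberTheory.EllipticCurves
  Literature.NumberTheory.GaloisRepresentations
  Literature.NumberTheory.EllipticCurves.BurungaleKobayashiNakamuraOta2026
  Literature.NumberTheory.DiophantineGeometry
  Summit.BirchSwinnertonDyer.Rank1Residual

namespace Summit.BirchSwinnertonDyer.BirchSwinnertonDyer.Theorems.RamifiedSevenEllipticUnits

namespace BottomClassReciprocityFrom

variable {K : Type} [Field K] [NumberField K] {p : ℕ} [Fact p.Prime] {W : WeierstrassCurve ℚ}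
  [W.IsElliptic] {𝔭 : HeightOneSpectrum (𝓞 K)} {κ : ZpExtension K p} {γ : absoluteGaloisGroup K}
  {ι : PadicAlgCl p ≃+* ℂ} {φ : HeckeCharacter K} {Ω : ℂ} {𝓔 : AcDualExpSystem W p K 𝔭 κ ι}

/-- **GATE (ii): the repaired predicate FIRES at the constructible level-`0` pair `(𝟙, 𝟙)`.** Under the
φ-pin and `W.HasEntireLFunction`, the continuation antecedent of `HasReciprocityFrom` at `χ = 𝟙` is
INHABITED (`hasEntireContinuationFrom_of_pin`) and the predicate yields the genuine central-value equation
`δ 0 𝟙 (z 0) = ι⁻¹(L(W, 1)/Ω)` (`L(W, 1) = W.entireLFunction 1`). No vacuous firing.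
[cite: BurungaleKobayashiNakamuraOta2026, Prop. 4.10 and Lemma 7.1 (arXiv:2608.06879 pp. 31, 40) (claim; preprint; shape only)]
[cite: SilvermanATAEC1994, Ch. II Thm. 10.5 (b)] -/
theorem delta_zero_eq_of_hasReciprocityFrom (D : EllipticUnitClassData W p K 𝔭 κ γ ι φ Ω 𝓔)
    (hR : X12.O11.HasReciprocityFrom D) (hW : W.HasEntireLFunction)
    (hpin : ∀ s : ℂ, 3 / 2 < s.re → heckeLFunction φ s = W.LSeries s) :
    𝓔.δ 0 (1 : FramedGaloisRep K (PadicAlgCl p) 1) (D.z 0) =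
      ((ι.symm (W.entireLFunction 1 / Ω) : PadicAlgCl p) : ℂ_[p]) := by
  have hL : LFunction.HasEntireContinuationFrom (3 / 2) (heckeLFunction (φ * 1)) := by
    rw [mul_one]
    exact HvanAnatomy.hasEntireContinuationFrom_of_pin hW hpin
  rw [hR.level_zero 1 1 (HvanAnatomy.isAcCharacter_zero_one_one ι κ) hL]
  congr 3
  rw [mul_one, HvanAnatomy.entireContinuationFrom_eq_entireLFunction_of_pin hW hpin]

/-- **GATES (i)+(ii) together: every level-`0` value vanishes in positive analytic rank.** A level-`0`
pair `(χ, r)` is `(𝟙, 𝟙)` (k7r-c3's rigidity `eq_one_of_isAcCharacter_zero` — the χ = 𝟙 reduction made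
explicit), the continuation from `re s > 3/2` exists and vanishes at `1` (`hvan'_of_pin`), and the repaired
reciprocity law turns this into `δ 0 r (z 0) = 0`.
[cite: BurungaleKobayashiNakamuraOta2026, Prop. 4.10 and Lemma 7.1 (arXiv:2608.06879 pp. 31, 40) (claim; preprint; shape only)] -/
theorem delta_zero_eq_zero_of_hasReciprocityFrom (D : EllipticUnitClassData W p K 𝔭 κ γ ι φ Ω 𝓔)
    (hR : X12.O11.HasReciprocityFrom D) (hW : W.HasEntireLFunction)
    (hpin : ∀ s : ℂ, 3 / 2 < s.re → heckeLFunction φ s = W.LSeries s) (hr : W.analyticRank ≠ 0)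
    (χ : HeckeCharacter K) (r : FramedGaloisRep K (PadicAlgCl p) 1) (hχ : IsAcCharacter ι κ 0 χ r) :
    𝓔.δ 0 r (D.z 0) = 0 := by
  obtain ⟨hL, h0⟩ := HvanAnatomy.hvan'_of_pin ι κ hW hpin hr χ r hχ
  rw [hR.level_zero χ r hχ hL, h0, zero_div, map_zero]
  rfl

/-- **(B1′) over the repaired predicate: the bottom elliptic-unit class lies in the FULL compact Selmer
group, `z(𝟙) ∈ S_p(E/K)`**, from `HasReciprocityFrom D`, the φ-pin, `L(W, ·)` entire and `r_an(W) ≠ 0`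
(k7r-c3's `bottom_mem_compactSelmerOver_of_erl'` fed with the level-`0` clause of the predicate).
[cite: BurungaleKobayashiNakamuraOta2026, Lemma 7.1 and Prop. 4.10 (arXiv:2608.06879 pp. 31, 40) (claim; preprint; shape only)] -/
theorem bottom_mem_compactSelmerOver_of_hasReciprocityFrom (D : EllipticUnitClassData W p K 𝔭 κ γ ι φ Ω 𝓔)
    (hR : X12.O11.HasReciprocityFrom D) (hW : W.HasEntireLFunction)
    (hpin : ∀ s : ℂ, 3 / 2 < s.re → heckeLFunction φ s = W.LSeries s) (hr : W.analyticRank ≠ 0) :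
    D.z 0 ∈ (W.baseChange K).compactSelmerOver (κ.layerSubgroup 0) p :=
  HvanAnatomy.bottom_mem_compactSelmerOver_of_erl' D
    (fun χ r hχ ↦ hR.level_zero χ r hχ (HvanAnatomy.hvan'_of_pin ι κ hW hpin hr χ r hχ).1) hW hpin hr

/-- **(B1′), modularity-fed form for the K7r value line**: with `L(W, ·)` entire from the named fact
`hasEntireLFunction_rat` (BCDT; conjunct 2 of `PublishedFactsSeven`) and `r_an(W) = 1` (a binder of the
value law), `HasReciprocityFrom D` and the pin give `z(𝟙) ∈ S_p(E/K)` — the input `hz` of k7r-c2's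
`RelaxedEqCompact.relaxed_le_mordellWeilKummerSpan_of_hasBottomIndexExpZp` (Ш-route to S_sat) and of any
S_open consumer. [cite: BurungaleKobayashiNakamuraOta2026, Lemma 7.1 (arXiv:2608.06879 p. 40) (claim; preprint; shape only)]
[cite: BCDTJAMS2001, Theorem A] -/
theorem bottom_mem_compactSelmerOver_of_hasReciprocityFrom_of_modularity
    (hmod : WeierstrassCurve.hasEntireLFunction_rat) (D : EllipticUnitClassData W p K 𝔭 κ γ ι φ Ω 𝓔)
    (hR : X12.O11.HasReciprocityFrom D)
    (hpin : ∀ s : ℂ, 3 / 2 < s.re → heckeLFunction φ s = W.LSeries s) (hr : W.analyticRank = 1) :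
    D.z 0 ∈ (W.baseChange K).compactSelmerOver (κ.layerSubgroup 0) p :=
  bottom_mem_compactSelmerOver_of_hasReciprocityFrom D hR (hmod W) hpin (by rw [hr]; exact one_ne_zero)

end BottomClassReciprocityFrom

end Summit.BirchSwinnertonDyer.BirchSwinnertonDyer.Theorems.RamifiedSevenEllipticUnits

end
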